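import Mathlib
import HarnessLib
import Summits.ValiantsHypothesis.ValiantsHypothesis.Theses.ChowBorderDepth3

/-!
# Route ChowBorderDepth3 — assembly

`Depth3Chasm → Depth3Thesis → (deg per_n = n) → (perFamily ∈ VP ↔ IsVPFamily per) → per ∈ VNP →
ValiantsHypothesis` (item stmt-ValiantsHypothesis-5941).

Bookkeeping: were `VP ℂ = VNP ℂ`, the permanent family would be a `VP` family (renaming bridge and
`per ∈ VNP`); the depth-three chasm then gives one `c` and, for every `n`, a product-depth-≤1 circuit
computing `per_n` with at most `(n+2)^(c⌊√(deg per_n)⌋+c) = (n+2)^(c⌊√n⌋+c)` wires, contradicting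
`Depth3Thesis` at that `c`.
-/

set_option linter.dupNamespace false

namespace Summit.ValiantsHypothesis.ValiantsHypothesis.Theorems

open Summit.ValiantsHypothesis.ValiantsHypothesis.Theses.ChowBorderDepth3

/-- **Assembly** (item stmt-ValiantsHypothesis-5941 of route ChowBorderDepth3): the depth-three
chasm for `VP` families, the depth-three thesis for the permanent, `deg per_n = n`, the renaming
bridge `perFamily ∈ VP ↔ IsVPFamily per` and `per ∈ VNP` together imply `VP ℂ ≠ VNP ℂ`. [folklore] -/
theorem chowBorderDepth3_assembly_proof :
    Summit.ValiantsHypothesis.ValiantsHypothesis.Theses.ChowBorderDepth3.Assembly := by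
  unfold Assembly
  intro hChasm hX hdeg hbridge hVNP
  show Literature.Computability.AlgebraicComplexity.VP ℂ ≠
    Literature.Computability.AlgebraicComplexity.VNP ℂ
  intro hEq
  -- `per ∈ VNP = VP`, so the permanent is a `VP` family (renaming bridge)
  have hper : Literature.Computability.AlgebraicComplexity.perFamily ℂ ∈
      Literature.Computability.AlgebraicComplexity.VP ℂ := by
    rw [hEq]; exact hVNP
  have hVP : Literature.Computability.AlgebraicComplexity.IsVPFamily
      (fun n => Literature.Computability.AlgebraicComplexity.perPoly (Fin n) ℂ) := hbridge.1 hper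
  -- the depth-three chasm gives one `c` and, for every `n`, a small product-depth-≤1 circuit
  obtain ⟨c, hc⟩ := hChasm (fun n => Literature.Computability.AlgebraicComplexity.perPoly (Fin n) ℂ) hVP
  -- the thesis refuses that `c` at some `n`
  obtain ⟨n, hn⟩ := hX c
  obtain ⟨P, hP, hdepth, hsize⟩ := hc n
  rw [hdeg n] at hsize
  exact absurd (lt_of_lt_of_le (hn P hP hdepth) hsize) (lt_irrefl _)

end Summit.ValiantsHypothesis.ValiantsHypothesis.Theorems
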